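import Summits.Ventures.CertifiedManyBodySolver.Theses.CovHg1201M19b

/-! BC3 birth skeleton — route CovHg1201M19b («hubbard-cov-hg1201-1»), crux PatchBottom (planner hubbard-obs-lead g18, 2026-08-28).
Two genuine pieces by DENSITY VERTEX (captain §3.2 S3: WN filling rows read a neighbourhood of each parent density; parents at n = 183/200 first, n = 87/100 second): n ∈ [9/10, 183/200] (stub_bottom_nHigh, from the 183/200 parents) and n ∈ [87/100, 9/10] (stub_bottom_nLow, from 87/100 parents or the downward WN reach of the 183/200 rows). Assembly = interval union at n = 9/10. -/

noncomputable section

namespace Summit.Ventures.CertifiedManyBodySolver.Cruxes.PatchBottom.Birth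

open Set Filter Topology
open Summit.Ventures.CertifiedManyBodySolver.Observables
open Summit.Ventures.CertifiedManyBodySolver.Downfold
open Literature.MathematicalPhysics.QuantumLattice Literature.MathematicalPhysics.QuantumLattice.ThermodynamicLimit
open Literature.Probability.LatticeModels
open Matrix HubbardWave0
open scoped BigOperators ComplexOrder

/-- stub (≥ M): the bottom bundle on the upper density segment n ∈ [9/10, 183/200] (vertex parents at n = 183/200: the corner parent
(−27/50, 7/2) shared with PatchLeftEdge and ONE parent at (−13/25, 7/2); two END-objective reads per vertex, σ-chord, WN rows downward). -/
def BottomNHigh : Prop :=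
    ∀ n ∈ Icc (9 / 10 : ℝ) (183 / 200), ∀ σ ∈ Icc (-27 / 50 : ℝ) (-13 / 25), ∀ s ∈ Icc (-27 / 50 : ℝ) σ,
    ∀ (ω : InfVolFermionState 2) (Ls : ℕ → ℕ) (ψ : ∀ L, Fock (Orb (FermionTorus 2 L))),
    Tendsto Ls atTop atTop →
    (∀ j, IsGroundStateInSector (hubbardTorusTT' (Ls j) 1 s (7 / 2)) (rectN n (Ls j)) 0 (ψ (Ls j))) →
    (∀ j, star (ψ (Ls j)) ⬝ᵥ ψ (Ls j) = 1) → ω.IsTorusLimitOf ψ Ls →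
    -(5166800 / 10000000 : ℝ) ≤ ((Finset.univ : Finset (DihedralGroup 4)).card : ℝ)⁻¹ * ∑ g ∈ (Finset.univ : Finset (DihedralGroup 4)),
      (ω.expect (d4ShiftSet g 0 (box 2 7)) (fermionEmbed (PolySite.d4Emb g 0 (box 2 7)) (-oddMomentObsTT σ (7 / 2) 0))).re

/-- registered stub: `BottomNHigh`. -/
theorem stub_bottom_nHigh : BottomNHigh := by
  sorry

/-- stub (≥ M): the bottom bundle on the lower density segment n ∈ [87/100, 9/10] (second density-vertex parents at n = 87/100, or the WN reach
of the 183/200 rows if the printed filling-multiplier slope closes the segment). -/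
def BottomNLow : Prop :=
    ∀ n ∈ Icc (87 / 100 : ℝ) (9 / 10), ∀ σ ∈ Icc (-27 / 50 : ℝ) (-13 / 25), ∀ s ∈ Icc (-27 / 50 : ℝ) σ,
    ∀ (ω : InfVolFermionState 2) (Ls : ℕ → ℕ) (ψ : ∀ L, Fock (Orb (FermionTorus 2 L))),
    Tendsto Ls atTop atTop →
    (∀ j, IsGroundStateInSector (hubbardTorusTT' (Ls j) 1 s (7 / 2)) (rectN n (Ls j)) 0 (ψ (Ls j))) →
    (∀ j, star (ψ (Ls j)) ⬝ᵥ ψ (Ls j) = 1) → ω.IsTorusLimitOf ψ Ls →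
    -(5166800 / 10000000 : ℝ) ≤ ((Finset.univ : Finset (DihedralGroup 4)).card : ℝ)⁻¹ * ∑ g ∈ (Finset.univ : Finset (DihedralGroup 4)),
      (ω.expect (d4ShiftSet g 0 (box 2 7)) (fermionEmbed (PolySite.d4Emb g 0 (box 2 7)) (-oddMomentObsTT σ (7 / 2) 0))).re

/-- registered stub: `BottomNLow`. -/
theorem stub_bottom_nLow : BottomNLow := by
  sorry

/-- BC3 assembly: the two density segments give the crux (interval union at n = 9/10). -/
theorem PatchBottom_of : Summit.Ventures.CertifiedManyBodySolver.Theses.CovHg1201M19b.PatchBottom := by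
  intro n hn σ hσ s hs
  rcases le_total (9 / 10 : ℝ) n with h | h
  · exact stub_bottom_nHigh n ⟨h, hn.2⟩ σ hσ s hs
  · exact stub_bottom_nLow n ⟨hn.1, h⟩ σ hσ s hs

end Summit.Ventures.CertifiedManyBodySolver.Cruxes.PatchBottom.Birth

end
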